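import Mathlib
import Summits.Ventures.PercRepro2.UniversalSeriesStep

/-! # The series step of (UH*) from the fibre package — the kinds, the assignment and its case lemmas
(seat mine-b, cell pub-perc-repro2; MINE-B.md §28.5)

`universal_ser_of_maps` (UniversalSeriesStep.lean) needs a residual assignment `ψ` that the fibre-wise
design cannot always supply for a general second factor (§27.2).  Here the series product `X ∧ Y` gets
(UH*) from data that are MATCHINGS on the factors alone:

* `f`, `g` — (UH*) assignments of `X` and `Y`;
* `σ`, `τ` — downward maps, injective on the blue-positive elements, with red label `≥ 1` (the drop-free
  Harris relays); `τ` must AGREE with `g` on the UNIT sources of `Y` (`b' z = 1`): `τ z = g (z, 0)` — `σ`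
  need not (the rule R1 takes precedence over R2, and the two are separated by their second coordinate);
* `A x z k` — for a source `x` of `X` with `b x ≥ 2` and a blue-positive `z` of `Y` that is not a unit
  source, the `k`-th unit of `(x, z)` (`k < min (b x) (b' z)`) is sent to the fibre `f (x, i)` at the
  second coordinate `w`, `(i, w) = A x z k`: `w ≤ z`, `r' w ≥ 1`, `b' w ≥ min (b x) (b' z) − 1`, `w` not a
  `g`-image of a unit source nor of a slot of index `< i`, injective in `(z, k)`;
* `B z u k` — symmetrically for a source `z` of `Y` with `b' z ≥ 2` and a red-positive blue-positive `u` of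
  `X`: the first coordinate `y`, `(j, y) = B z u k`, with `y` not an `f`-image of a slot of index `≤ j`.

This file: the four kinds of a product slot (`serKind`), the assignment `fibAssign` and its value on each
kind (`fibAssign_r1` … `fibAssign_r4`); the theorem is UniversalSeriesFibres.lean.  The assignment: (R1) `z` a unit source of `Y`: `(x, z) ↦ (σ x, g (z, 0))`; (R2) `x` a unit source of `X`,
`z` not one: `(x, z) ↦ (f (x, 0), τ z)`; (R3) `x` a source with `b x ≥ 2`, `z` not a unit source:
`(x, z, k) ↦ (f (x, i), w)`; (R4) `x` red-positive, `z` a source with `b' z ≥ 2`: `(u, z, k) ↦ (y, g (z, j))`.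
The two fibre families meet only at `(f (x, i), g (z, j))`, where an R3-image needs `j ≥ i` and an R4-image
needs `i > j`.  Red labels are `min 1 _ = 1`, blue levels are automatic.  Census of the data: MINE-B.md §28.6. -/

namespace Summit.Ventures.PercRepro2.UHClosure

open Finset
open Summit.Ventures.PercRepro2.V2Closure (serR serB)

variable {X Y : Type*} [Preorder X] [Preorder Y] [Fintype X] [Fintype Y]

section fibres

variable (r b : X → ℕ) (r' b' : Y → ℕ)

/-- the slot of index `i` of a source `x` -/
def mkSlot (x : X) (hx : USrc r b x) (i : ℕ) (hi : i < b x) : SlotL (USrc r b) b :=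
  ⟨⟨⟨x, hx, hx.2⟩, ⟨i, lt_of_lt_of_le hi (le_of_lt (lt_boundL b x))⟩⟩, hi⟩

omit [Preorder X] [Preorder Y] [Fintype Y] in
/-- the source of `mkSlot` -/
@[simp] lemma mkSlot_src (x : X) (hx : USrc r b x) (i : ℕ) (hi : i < b x) :
    (mkSlot r b x hx i hi).1.1.1 = x := rfl

omit [Preorder X] [Preorder Y] [Fintype Y] in
/-- the index of `mkSlot` -/
@[simp] lemma mkSlot_idx (x : X) (hx : USrc r b x) (i : ℕ) (hi : i < b x) :
    (mkSlot r b x hx i hi).1.2.val = i := rfl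

omit [Preorder X] [Preorder Y] in
/-- a unit source of the series product has demand `1`: its only slot has index `0` -/
lemma ser_idx_zero_of_unit {q : SlotL (USrc (serR r r') (serB b b')) (serB b b')}
    (h : b q.1.1.1.1 = 1 ∨ b' q.1.1.1.2 = 1) : q.1.2.val = 0 := by
  have := q.2; simp only [serB] at this; omega

omit [Preorder X] [Preorder Y] in
/-- the index of a product slot is below both blue labels -/
lemma ser_idx_lt (q : SlotL (USrc (serR r r') (serB b b')) (serB b b')) :
    q.1.2.val < b q.1.1.1.1 ∧ q.1.2.val < b' q.1.1.1.2 := by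
  have := q.2; simp only [serB] at this; omega

/-- the kinds of a product slot -/
inductive SerKind where
  | r1 | r2 | r3 | r4
  deriving DecidableEq

/-- the kind of a product slot: R1 if the second coordinate is a unit source, else R2 if the first is,
else R3 if the first is a source, else R4 -/
def serKind (q : SlotL (USrc (serR r r') (serB b b')) (serB b b')) : SerKind :=
  if r' q.1.1.1.2 = 0 ∧ b' q.1.1.1.2 = 1 then .r1
  else if r q.1.1.1.1 = 0 ∧ b q.1.1.1.1 = 1 then .r2
  else if r q.1.1.1.1 = 0 then .r3 else .r4

omit [Preorder X] [Preorder Y] in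
/-- what kind R1 means -/
lemma serKind_r1 {q : SlotL (USrc (serR r r') (serB b b')) (serB b b')} (h : serKind r b r' b' q = .r1) :
    r' q.1.1.1.2 = 0 ∧ b' q.1.1.1.2 = 1 := by
  unfold serKind at h
  split_ifs at h with h1 h2 h3
  exact h1

omit [Preorder X] [Preorder Y] in
/-- what kind R2 means -/
lemma serKind_r2 {q : SlotL (USrc (serR r r') (serB b b')) (serB b b')} (h : serKind r b r' b' q = .r2) :
    ¬ (r' q.1.1.1.2 = 0 ∧ b' q.1.1.1.2 = 1) ∧ r q.1.1.1.1 = 0 ∧ b q.1.1.1.1 = 1 := by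
  unfold serKind at h
  split_ifs at h with h1 h2 h3
  exact ⟨h1, h2⟩

omit [Preorder X] [Preorder Y] in
/-- what kind R3 means -/
lemma serKind_r3 {q : SlotL (USrc (serR r r') (serB b b')) (serB b b')} (h : serKind r b r' b' q = .r3) :
    ¬ (r' q.1.1.1.2 = 0 ∧ b' q.1.1.1.2 = 1) ∧ ¬ (r q.1.1.1.1 = 0 ∧ b q.1.1.1.1 = 1) ∧ r q.1.1.1.1 = 0 := by
  unfold serKind at h
  split_ifs at h with h1 h2 h3
  exact ⟨h1, h2, h3⟩

omit [Preorder X] [Preorder Y] in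
/-- what kind R4 means -/
lemma serKind_r4 {q : SlotL (USrc (serR r r') (serB b b')) (serB b b')} (h : serKind r b r' b' q = .r4) :
    ¬ (r' q.1.1.1.2 = 0 ∧ b' q.1.1.1.2 = 1) ∧ ¬ (r q.1.1.1.1 = 0 ∧ b q.1.1.1.1 = 1) ∧ ¬ r q.1.1.1.1 = 0 := by
  unfold serKind at h
  split_ifs at h with h1 h2 h3
  exact ⟨h1, h2, h3⟩

omit [Preorder X] [Preorder Y] in
/-- R1: the second coordinate is a unit source of `Y` -/
lemma r1_src {q : SlotL (USrc (serR r r') (serB b b')) (serB b b')} (h : serKind r b r' b' q = .r1) :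
    USrc r' b' q.1.1.1.2 := ⟨(serKind_r1 r b r' b' h).1, by have := (serKind_r1 r b r' b' h).2; omega⟩

omit [Preorder X] [Preorder Y] in
/-- R1: the second coordinate has a slot of index `0` -/
lemma r1_pos {q : SlotL (USrc (serR r r') (serB b b')) (serB b b')} (h : serKind r b r' b' q = .r1) :
    0 < b' q.1.1.1.2 := by have := (serKind_r1 r b r' b' h).2; omega

omit [Preorder X] [Preorder Y] in
/-- R2: the first coordinate is a unit source of `X` -/
lemma r2_src {q : SlotL (USrc (serR r r') (serB b b')) (serB b b')} (h : serKind r b r' b' q = .r2) :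
    USrc r b q.1.1.1.1 := ⟨(serKind_r2 r b r' b' h).2.1, by have := (serKind_r2 r b r' b' h).2.2; omega⟩

omit [Preorder X] [Preorder Y] in
/-- R2: the first coordinate has a slot of index `0` -/
lemma r2_pos {q : SlotL (USrc (serR r r') (serB b b')) (serB b b')} (h : serKind r b r' b' q = .r2) :
    0 < b q.1.1.1.1 := by have := (serKind_r2 r b r' b' h).2.2; omega

omit [Preorder X] [Preorder Y] in
/-- an R4 slot has a source second coordinate with `b' ≥ 2` and a red-positive blue-positive first coordinate -/
lemma r4_facts {q : SlotL (USrc (serR r r') (serB b b')) (serB b b')} (h : serKind r b r' b' q = .r4) :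
    r' q.1.1.1.2 = 0 ∧ 2 ≤ b' q.1.1.1.2 ∧ 1 ≤ r q.1.1.1.1 ∧ 1 ≤ b q.1.1.1.1 := by
  obtain ⟨h1, -, h3⟩ := serKind_r4 r b r' b' h
  have hred := ser_src_red r b r' b' q.1.1.2.1
  have hblue := ser_src_blue r b r' b' q.1.1.2.1
  have hz : r' q.1.1.1.2 = 0 := by
    rcases hred with h | h
    · exact absurd h h3
    · exact h
  refine ⟨hz, ?_, by omega, hblue.1⟩
  by_contra hlt; exact h1 ⟨hz, by omega⟩

omit [Preorder X] [Preorder Y] in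
/-- R4: the second coordinate is a source of `Y` -/
lemma r4_src {q : SlotL (USrc (serR r r') (serB b b')) (serB b b')} (h : serKind r b r' b' q = .r4) :
    USrc r' b' q.1.1.1.2 := ⟨(r4_facts r b r' b' h).1, by have := (r4_facts r b r' b' h).2.1; omega⟩

omit [Preorder X] [Preorder Y] in
/-- R4: the index is a unit index of `(z, u)` -/
lemma r4_idx {q : SlotL (USrc (serR r r') (serB b b')) (serB b b')} (_h : serKind r b r' b' q = .r4) :
    q.1.2.val < min (b' q.1.1.1.2) (b q.1.1.1.1) := by
  have := ser_idx_lt r b r' b' q; omega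

omit [Preorder X] [Preorder Y] in
/-- an R3 slot: the first coordinate is a source with `b ≥ 2`, the second is blue-positive and not a unit source -/
lemma r3_facts {q : SlotL (USrc (serR r r') (serB b b')) (serB b b')} (h : serKind r b r' b' q = .r3) :
    r q.1.1.1.1 = 0 ∧ 2 ≤ b q.1.1.1.1 ∧ 1 ≤ b' q.1.1.1.2 ∧ ¬ (r' q.1.1.1.2 = 0 ∧ b' q.1.1.1.2 = 1) := by
  obtain ⟨h1, h2, h3⟩ := serKind_r3 r b r' b' h
  have hblue := ser_src_blue r b r' b' q.1.1.2.1
  refine ⟨h3, ?_, hblue.2, h1⟩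
  by_contra hlt; exact h2 ⟨h3, by omega⟩

omit [Preorder X] [Preorder Y] in
/-- R3: the first coordinate is a source of `X` -/
lemma r3_src {q : SlotL (USrc (serR r r') (serB b b')) (serB b b')} (h : serKind r b r' b' q = .r3) :
    USrc r b q.1.1.1.1 := ⟨(r3_facts r b r' b' h).1, by have := (r3_facts r b r' b' h).2.1; omega⟩

omit [Preorder X] [Preorder Y] in
/-- R3: the index is a unit index of `(x, z)` -/
lemma r3_idx {q : SlotL (USrc (serR r r') (serB b b')) (serB b b')} (_h : serKind r b r' b' q = .r3) :
    q.1.2.val < min (b q.1.1.1.1) (b' q.1.1.1.2) := by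
  have := ser_idx_lt r b r' b' q; omega

/-- the domain of the `A`-data: a source `x` with `b x ≥ 2`, a blue-positive `z` that is not a unit
source, a unit index `k` -/
def DomA (x : X) (z : Y) (k : ℕ) : Prop :=
  USrc r b x ∧ 2 ≤ b x ∧ 1 ≤ b' z ∧ ¬ (r' z = 0 ∧ b' z = 1) ∧ k < min (b x) (b' z)

/-- the domain of the `B`-data: a source `z` with `b' z ≥ 2`, a red-positive blue-positive `u`, a unit index -/
def DomB (z : Y) (u : X) (k : ℕ) : Prop :=
  USrc r' b' z ∧ 2 ≤ b' z ∧ 1 ≤ r u ∧ 1 ≤ b u ∧ k < min (b' z) (b u)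

omit [Preorder X] [Preorder Y] in
/-- an R3 slot lies in the domain of the `A`-data -/
lemma r3_dom {q : SlotL (USrc (serR r r') (serB b b')) (serB b b')} (hk : serKind r b r' b' q = .r3) :
    DomA r b r' b' q.1.1.1.1 q.1.1.1.2 q.1.2.val :=
  ⟨r3_src r b r' b' hk, (r3_facts r b r' b' hk).2.1, (r3_facts r b r' b' hk).2.2.1,
    (r3_facts r b r' b' hk).2.2.2, r3_idx r b r' b' hk⟩

omit [Preorder X] [Preorder Y] in
/-- an R4 slot lies in the domain of the `B`-data -/
lemma r4_dom {q : SlotL (USrc (serR r r') (serB b b')) (serB b b')} (hk : serKind r b r' b' q = .r4) :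
    DomB r b r' b' q.1.1.1.2 q.1.1.1.1 q.1.2.val :=
  ⟨r4_src r b r' b' hk, (r4_facts r b r' b' hk).2.1, (r4_facts r b r' b' hk).2.2.1,
    (r4_facts r b r' b' hk).2.2.2, r4_idx r b r' b' hk⟩

omit [Preorder X] [Preorder Y] [Fintype Y] in
/-- equal images of injective `f` on `mkSlot`s give equal sources and indices -/
lemma mkSlot_inj {f : SlotL (USrc r b) b → X} (hf : Function.Injective f) {x x' : X} {hx : USrc r b x}
    {hx' : USrc r b x'} {i i' : ℕ} {hi : i < b x} {hi' : i' < b x'}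
    (h : f (mkSlot r b x hx i hi) = f (mkSlot r b x' hx' i' hi')) : x = x' ∧ i = i' := by
  have := hf h
  exact ⟨congrArg (fun s : SlotL (USrc r b) b => s.1.1.1) this,
    congrArg (fun s : SlotL (USrc r b) b => s.1.2.val) this⟩

/-- the fibre-package series assignment -/
noncomputable def fibAssign (f : SlotL (USrc r b) b → X) (g : SlotL (USrc r' b') b' → Y)
    (σ : X → X) (τ : Y → Y) (A : X → Y → ℕ → ℕ × Y) (B : Y → X → ℕ → ℕ × X)
    (hA1 : ∀ x z k, USrc r b x → 2 ≤ b x → 1 ≤ b' z → ¬ (r' z = 0 ∧ b' z = 1) → k < min (b x) (b' z) →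
      (A x z k).1 < b x)
    (hB1 : ∀ z u k, USrc r' b' z → 2 ≤ b' z → 1 ≤ r u → 1 ≤ b u → k < min (b' z) (b u) →
      (B z u k).1 < b' z)
    (q : SlotL (USrc (serR r r') (serB b b')) (serB b b')) : X × Y :=
  match hk : serKind r b r' b' q with
  | .r1 => (σ q.1.1.1.1, g (mkSlot r' b' q.1.1.1.2 (r1_src r b r' b' hk) 0 (r1_pos r b r' b' hk)))
  | .r2 => (f (mkSlot r b q.1.1.1.1 (r2_src r b r' b' hk) 0 (r2_pos r b r' b' hk)), τ q.1.1.1.2)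
  | .r3 =>
      (f (mkSlot r b q.1.1.1.1 (r3_src r b r' b' hk) (A q.1.1.1.1 q.1.1.1.2 q.1.2.val).1
          (hA1 _ _ _ (r3_src r b r' b' hk) (r3_facts r b r' b' hk).2.1 (r3_facts r b r' b' hk).2.2.1
            (r3_facts r b r' b' hk).2.2.2 (r3_idx r b r' b' hk))),
       (A q.1.1.1.1 q.1.1.1.2 q.1.2.val).2)
  | .r4 =>
      ((B q.1.1.1.2 q.1.1.1.1 q.1.2.val).2,
       g (mkSlot r' b' q.1.1.1.2 (r4_src r b r' b' hk) (B q.1.1.1.2 q.1.1.1.1 q.1.2.val).1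
          (hB1 _ _ _ (r4_src r b r' b' hk) (r4_facts r b r' b' hk).2.1 (r4_facts r b r' b' hk).2.2.1
            (r4_facts r b r' b' hk).2.2.2 (r4_idx r b r' b' hk))))

end fibres

section main

variable (r b : X → ℕ) (r' b' : Y → ℕ)
variable (f : SlotL (USrc r b) b → X) (g : SlotL (USrc r' b') b' → Y)
variable (σ : X → X) (τ : Y → Y) (A : X → Y → ℕ → ℕ × Y) (B : Y → X → ℕ → ℕ × X)
variable (hA1 : ∀ x z k, USrc r b x → 2 ≤ b x → 1 ≤ b' z → ¬ (r' z = 0 ∧ b' z = 1) → k < min (b x) (b' z) →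
      (A x z k).1 < b x)
variable (hB1 : ∀ z u k, USrc r' b' z → 2 ≤ b' z → 1 ≤ r u → 1 ≤ b u → k < min (b' z) (b u) →
      (B z u k).1 < b' z)

include hA1 hB1

omit [Preorder X] [Preorder Y] in
/-- the assignment on an R1 slot -/
lemma fibAssign_r1 {q : SlotL (USrc (serR r r') (serB b b')) (serB b b')} (hk : serKind r b r' b' q = .r1) :
    fibAssign r b r' b' f g σ τ A B hA1 hB1 q =
      (σ q.1.1.1.1, g (mkSlot r' b' q.1.1.1.2 (r1_src r b r' b' hk) 0 (r1_pos r b r' b' hk))) := by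
  unfold fibAssign
  split
  · rfl
  all_goals (rename_i heq; rw [hk] at heq; cases heq)

omit [Preorder X] [Preorder Y] in
/-- the assignment on an R2 slot -/
lemma fibAssign_r2 {q : SlotL (USrc (serR r r') (serB b b')) (serB b b')} (hk : serKind r b r' b' q = .r2) :
    fibAssign r b r' b' f g σ τ A B hA1 hB1 q =
      (f (mkSlot r b q.1.1.1.1 (r2_src r b r' b' hk) 0 (r2_pos r b r' b' hk)), τ q.1.1.1.2) := by
  unfold fibAssign
  split
  all_goals first
    | rfl
    | (rename_i heq; rw [hk] at heq; cases heq)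

omit [Preorder X] [Preorder Y] in
/-- the assignment on an R3 slot -/
lemma fibAssign_r3 {q : SlotL (USrc (serR r r') (serB b b')) (serB b b')} (hk : serKind r b r' b' q = .r3) :
    fibAssign r b r' b' f g σ τ A B hA1 hB1 q =
      (f (mkSlot r b q.1.1.1.1 (r3_src r b r' b' hk) (A q.1.1.1.1 q.1.1.1.2 q.1.2.val).1
          (hA1 _ _ _ (r3_src r b r' b' hk) (r3_facts r b r' b' hk).2.1 (r3_facts r b r' b' hk).2.2.1
            (r3_facts r b r' b' hk).2.2.2 (r3_idx r b r' b' hk))),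
       (A q.1.1.1.1 q.1.1.1.2 q.1.2.val).2) := by
  unfold fibAssign
  split
  all_goals first
    | rfl
    | (rename_i heq; rw [hk] at heq; cases heq)

omit [Preorder X] [Preorder Y] in
/-- the assignment on an R4 slot -/
lemma fibAssign_r4 {q : SlotL (USrc (serR r r') (serB b b')) (serB b b')} (hk : serKind r b r' b' q = .r4) :
    fibAssign r b r' b' f g σ τ A B hA1 hB1 q =
      ((B q.1.1.1.2 q.1.1.1.1 q.1.2.val).2,
       g (mkSlot r' b' q.1.1.1.2 (r4_src r b r' b' hk) (B q.1.1.1.2 q.1.1.1.1 q.1.2.val).1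
          (hB1 _ _ _ (r4_src r b r' b' hk) (r4_facts r b r' b' hk).2.1 (r4_facts r b r' b' hk).2.2.1
            (r4_facts r b r' b' hk).2.2.2 (r4_idx r b r' b' hk)))) := by
  unfold fibAssign
  split
  all_goals first
    | rfl
    | (rename_i heq; rw [hk] at heq; cases heq)

end main

end Summit.Ventures.PercRepro2.UHClosure
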